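import Literature.Computability.AlgebraicComplexity.BILPS19LatinRectangleConditionAdditivity
import Mathlib.NumberTheory.Bertrand
import HarnessLib

/-!
# The Latin-rectangle condition `LRC(α, β)` holds for EVERY `α` and every even `β ≥ 2α²`;
# BILPS Thm 27 unconditionally for all `k` and all even `m ≥ 2k²`

Bläser–Ikenmeyer–Lysikov–Pandey–Schreyer, arXiv:1911.02534, §7.3 (held text `paper:arxiv-1911.02534`
p0026:L21–33): Conjecture 26 = `LRC(α, β)` for every `α` and every even `β ≥ α` (the typed
HYPOTHESIS `latinRectangleCondition` of the tree fact `BILPS2019_thm27`, discharged as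
`BILPS2019_thm27_holds`). The source records the known cases `α ≤ 5` (Foulkes' conjecture work) and
`β = p ± 1` (Alon–Tarsi, Drisko/Glynn) with Kumar's monotonicity.

This theorem-only file proves an UNCONDITIONAL ASYMPTOTIC FORM of Conjecture 26: for every `α`, the
condition `LRC(α, β)` holds for all even `β ≥ 2α²` (`latinRectangleCondition_of_two_mul_sq_le`). Route
(ours, elementary on top of the tree): Bertrand's postulate (Mathlib) gives an odd prime `p` with
`α < p ≤ 2α`; the tree's Alon–Tarsi theorems for `p − 1` (Glynn) and `p + 1` (Drisko) with Kumar's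
row monotonicity give `LRC(α, p − 1)` and `LRC(α, p + 1)` (sibling file
`BILPS19LatinRectangleConditionAlonTarsi.lean`); block ADDITIVITY of `LRC` in `β`
(`latinRectangleCondition_add`, sibling file `BILPS19LatinRectangleConditionAdditivity.lean`) then
gives `LRC(α, x(p−1) + y(p+1))`, and every even `β ≥ (p−1)(p−3)/2` — in particular every even
`β ≥ 2α²` — is of this form (coin problem for the consecutive integers `(p−1)/2`, `(p+1)/2`).
Consequence: `BILPS2019_thm27_of_two_mul_sq_le` — BILPS Thm 27 with its Latin-rectangle hypothesis
DISCHARGED for every `k` and every even `m ≥ 2k²`.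

Honest framing: the asymptotic statement is consistent with (and weaker in range than) what the
plethysm literature knows via Brion's theorem on Foulkes' conjecture for `β ≫ α`; it is recorded here
because it follows inside the tree from theorems already kernel-checked. No definitions, no named
facts; nothing here bears on `VP ≠ VNP` (equations for the MINRANK varieties).

## References
* [BlaserIkenmeyerLysikovPandeySchreyer2019] arXiv:1911.02534, §7.3: Conj. 26 and the remarks
  after it (p0026:L21–33), Thm. 27 (p0026:L36–40).
-/

noncomputable section

namespace Literature.Computability.AlgebraicComplexity

namespace BILPS2019

open Kumar2015 Literature.Barriers.ValiantsHypothesis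

/-- Coin problem for two consecutive integers: every `t ≥ u(u−1)` is `x·u + y·(u+1)` (`u ≥ 1`).
[folklore] -/
private theorem exists_eq_mul_add_mul_succ {u t : ℕ} (hu : 1 ≤ u) (ht : u * (u - 1) ≤ t) :
    ∃ x y : ℕ, t = x * u + y * (u + 1) := by
  set q := t / u with hq
  set r := t % u with hr
  have hru : r < u := Nat.mod_lt _ hu
  have htqr : t = q * u + r := by rw [hq, hr, Nat.div_add_mod']
  -- `u (u - 1) ≤ t < (q + 1) u` forces `u - 1 ≤ q`, hence `r ≤ q`
  have hlt : u * (u - 1) < u * (q + 1) := by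
    calc u * (u - 1) ≤ t := ht
      _ = q * u + r := htqr
      _ < q * u + u := by omega
      _ = u * (q + 1) := by ring
  have hq1 : u - 1 < q + 1 := Nat.lt_of_mul_lt_mul_left hlt
  have hrq : r ≤ q := by omega
  obtain ⟨d, hd⟩ := Nat.exists_eq_add_of_le hrq
  refine ⟨d, r, ?_⟩
  rw [htqr, hd]
  ring

/-- `LRC(α, x(p−1) + y(p+1))` for an odd prime `p > α` and `x + y ≥ 1`: the bases `LRC(α, p ∓ 1)`
(Glynn/Drisko + Kumar) propagated by block additivity.
[cite: BlaserIkenmeyerLysikovPandeySchreyer2019, §7.3 (remarks after Conj. 26)] -/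
theorem latinRectangleCondition_of_prime_parts {α p x y : ℕ} (hp : p.Prime) (hodd : Odd p)
    (hα : α ≤ p - 1) (hxy : 1 ≤ x + y) :
    latinRectangleCondition α (x * (p - 1) + y * (p + 1)) := by
  have hsub : latinRectangleCondition α (p - 1) := latinRectangleCondition_prime_sub_one hp hodd hα
  have hadd : latinRectangleCondition α (p + 1) :=
    latinRectangleCondition_prime_add_one hp hodd (by omega)
  rcases Nat.eq_zero_or_pos x with rfl | hx
  · rw [zero_mul, zero_add]
    exact latinRectangleCondition_mul (by omega) hadd
  rcases Nat.eq_zero_or_pos y with rfl | hy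
  · rw [zero_mul, add_zero]
    exact latinRectangleCondition_mul hx hsub
  exact latinRectangleCondition_add (latinRectangleCondition_mul hx hsub)
    (latinRectangleCondition_mul hy hadd)

/-- **Conjecture 26 holds asymptotically, unconditionally: `LRC(α, β)` for every `α` and every even
`β ≥ 2α²`.** (Bertrand: an odd prime `p` with `α < p ≤ 2α`; every even `β ≥ 2α² ≥ (p−1)(p−3)/2` is
`x(p−1) + y(p+1)`; `latinRectangleCondition_of_prime_parts`.) For `α ≤ 1` every `β` works
(`latinRectangleCondition_one`). [cite: BlaserIkenmeyerLysikovPandeySchreyer2019, §7.3 (Conj. 26)] -/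
theorem latinRectangleCondition_of_two_mul_sq_le {α β : ℕ} (hβ : 2 * α ^ 2 ≤ β) (he : Even β) :
    latinRectangleCondition α β := by
  rcases Nat.lt_or_ge α 2 with hα | hα
  · interval_cases α
    · exact latinRectangleCondition_anti (Nat.zero_le 1) (latinRectangleCondition_one β)
    · exact latinRectangleCondition_one β
  obtain ⟨p, hp, hαp, hp2⟩ := Nat.exists_prime_lt_and_le_two_mul α (by omega)
  have hodd : Odd p := hp.odd_of_ne_two (by omega)
  obtain ⟨u, hu⟩ := hodd
  obtain ⟨t, rfl⟩ := he
  have hu1 : 1 ≤ u := by omega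
  have hsq : 4 ≤ α ^ 2 := by nlinarith
  have ht : u * (u - 1) ≤ t := by
    have hua : u ≤ α := by omega
    have h1 : u * (u - 1) ≤ α * α := Nat.mul_le_mul hua (by omega)
    nlinarith
  obtain ⟨x, y, hxy⟩ := exists_eq_mul_add_mul_succ hu1 ht
  have hxy1 : 1 ≤ x + y := by
    rcases Nat.eq_zero_or_pos (x + y) with h0 | h0
    · have hx0 : x = 0 := by omega
      have hy0 : y = 0 := by omega
      subst hx0 hy0
      simp at hxy
      omega
    · exact h0
  have hβ' : t + t = x * (p - 1) + y * (p + 1) := by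
    rw [show p - 1 = 2 * u by omega, show p + 1 = 2 * u + 2 by omega, hxy]
    ring
  rw [hβ']
  exact latinRectangleCondition_of_prime_parts hp ⟨u, hu⟩ (by omega) hxy1

/-- The set of even `β` for which `LRC(α, β)` fails is bounded (by `2α²`): Conjecture 26 has at most
finitely many exceptional shapes for each `α`. [cite: BlaserIkenmeyerLysikovPandeySchreyer2019, §7.3 (Conj. 26)] -/
theorem latinRectangleCondition_eventually (α : ℕ) :
    ∃ B : ℕ, ∀ β, B ≤ β → Even β → latinRectangleCondition α β :=
  ⟨2 * α ^ 2, fun _ hβ he => latinRectangleCondition_of_two_mul_sq_le hβ he⟩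

end BILPS2019

/-! ## BILPS Thm 27 for every `k` and every even `m ≥ 2k²` -/

open BILPS2019

/-- **BILPS Thm 27 UNCONDITIONALLY for every `k` and every even `m ≥ 2k²`**: for `m ≤ n`, `kr < m`,
`kr < n`, `m` even with `2k² ≤ m`, the minrank variety `𝓜_r ⊆ F^{k×m×n}` (`F` algebraically closed
of characteristic `0`) has a nonzero homogeneous equation of degree `km` — `BILPS2019_thm27_holds`
with `LRC(k, m)` DISCHARGED by `latinRectangleCondition_of_two_mul_sq_le`.
[cite: BlaserIkenmeyerLysikovPandeySchreyer2019, Thm. 27 and §7.3 (Conj. 26)] -/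
theorem BILPS2019_thm27_of_two_mul_sq_le (F : Type) [Field F] [IsAlgClosed F] [CharZero F]
    (k m n r : ℕ) (hmn : m ≤ n) (hm : k * r < m) (hn : k * r < n) (hkm : 2 * k ^ 2 ≤ m)
    (heven : Even m) :
    ∃ f : MvPolynomial (Fin k × Fin m × Fin n) F, f ≠ 0 ∧ f.IsHomogeneous (k * m) ∧
      ∀ T ∈ (minrankSet F r : Set (Fin k → Fin m → Fin n → F)),
        MvPolynomial.eval (trilinearPt T) f = 0 :=
  BILPS2019_thm27_holds F k m n r hmn hm hn (latinRectangleCondition_of_two_mul_sq_le hkm heven)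

end Literature.Computability.AlgebraicComplexity
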